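import Summits.BirchSwinnertonDyer.BirchSwinnertonDyer.Theorems.UniversalToricDescentTwinHowardConclusion
import Summits.BirchSwinnertonDyer.BirchSwinnertonDyer.Theorems.UniversalToricDescentEisensteinHowardRankReadout
import Summits.BirchSwinnertonDyer.BirchSwinnertonDyer.Theorems.PrintX10bControlDiscreteGlue
import Literature.NumberTheory.EllipticCurves.ZpExtensionEisensteinTowerReadoutBijectiveProofs
import Literature.NumberTheory.GaloisCohomology.Howard2004.ConclusionHonestModuleProofs
import Literature.NumberTheory.GaloisCohomology.Howard2004.ConclusionTorsionCurrencyProofs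
import HarnessLib

/-!
# (H-ii) of the K2 stub from HOWARD'S CONCLUSION: the rank readout glue `lambdaInvariant_le_of_dvrConclusion_of_readout`
# (generic), and on the twin frame `hrank_of_conclusion` / `twin_hrank_of_conclusion` (`p = 3`, unconditionally)

Summits-side helper toward the registered stub `stub_howardOutputsOfFamily` (K2) of line `beta-road` (skeleton v10
cd44fe9d5c6b9a78) of crux r205 stmt-BirchSwinnertonDyer-24737 `…Theses.UniversalToricDescent.TwinAlgMuZeroAtThree` (LEAD
lineage `bsd-wall-utd-p1`, g26; `--supports`).  ROUTE-INDEPENDENT; THEOREMS ONLY (no definition, no named fact, no instance,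
no `sorry`).

The K2 stub's second conjunct (H-ii) is `∀ m₀ ∃ m ≥ m₀, λ(X/q_m X) ≤ m + C` (`X` the Pontryagin dual of `Sel_{3^∞}(E′/K_∞)`,
`q_m = T^m + 3`).  Width seat utd-p1-w2 g11 proved the READOUT ALGEBRA
(`UniversalToricDescentEisensteinHowardRankReadout.lambdaInvariant_quotient_qm_le_of_howardShape_readout`, p750016: a map
`ι : Φ_m/S_m × (M × M) →+ Sel_∞` into `ker ψ_m` with finite index and `p^e`-torsion kernel gives `λ(X/q_m X) ≤ m`).  This file
SUPPLIES that map from Howard's `Conclusion` (ii) of Thm. 1.6.1 (`H¹_{F_𝔮}(K, A_𝔮) ≅ 𝒟 ⊕ M ⊕ M`, opened by lit's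
`DVRSetting.Conclusion.exists_semilinear`) and the READOUT `H¹(K, A_𝔮) → H¹(K_∞, E[p^∞])` with its three properties (hT) /
(hSel) = (B4) / (hfin, hidx) = (B5) — exactly the discrete-side inputs of x10b's `nonempty_specWitness_of_dvrConclusion_of_readout`,
whose construction of `ι𝒜 = ι₀ ∘ Φ⁻¹` is repeated here — plus INJECTIVITY of the readout (`eisensteinTowerReadout_injective`,
from `E(K)[p] = 0`), which makes the kernel exponent `e = 0`:
* **`lambdaInvariant_le_of_dvrConclusion_of_readout`** — GENERIC in the `DVRSetting` over `S_m`: Conclusion + injective readout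
  with (hT)/(hSel)/(hfin, hidx) ⟹ `λ(𝒳/q_m 𝒳) ≤ m`;
* **`hrank_of_conclusion`** — on the twin frame at a prime `p` where (B5) `Stmt.readoutIndexMultAt p` is given ((B4) is the theorem
  `readoutSelmerMultAt_holds`): `Stmt.conclusionAtControlLevels p … D z` ⟹ `∀ m₀ ∃ m ≥ m₀, λ(𝒳/q_m 𝒳) ≤ m + C` (every `C`);
* **`twin_hrank_of_conclusion`** — in the binders of crux 24737 at `p = 3` ((B5) = `readoutIndexMultAt_three`, p765199): conjunct
  (H-ii) of `stub_howardOutputsOfFamily` VERBATIM from `Stmt.conclusionAtControlLevels 3 …`, unconditionally.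
With `UniversalToricDescentTwinHowardConclusion.twin_hKS_of_conclusion` ((H-iii)), BOTH dual-side outputs of the K2 stub now follow
from the single input «Howard's conclusion at the control levels of `z` for all large `m`».  What this is NOT: that input (KS-twin
beyond print + F-161′), (H-i′) (the compact-control KERNEL modulo `q_m`), K1, C₀.  No summit statement is proved; BSD is not proved.

References: [Howard2004HeegnerKolyvagin] Thm. 1.6.1 (ii), Prop. 2.2.8 (second map) and proof of Thm. 2.2.10 (𝔮 = T^m + p);
[GreenbergLNM1716] §4 p. 98 (`X/θX` dual to `Sel[θ]`).
-/

set_option linter.dupNamespace false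
set_option autoImplicit false

noncomputable section

open scoped Classical Pointwise ContRepresentation TensorProduct NumberField nonZeroDivisors

open Function NumberField IsDedekindDomain Field
open Literature Literature.NumberTheory.EllipticCurves WeierstrassCurve
open Literature.NumberTheory.GaloisCohomology Literature.NumberTheory.GaloisCohomology.Howard2004
open Literature.NumberTheory.GaloisRepresentations Literature.NumberTheory.GaloisRepresentations.DiscreteGaloisModule
open Literature.NumberTheory.GaloisRepresentations.galoisCohomology
open Summit.BirchSwinnertonDyer.BirchSwinnertonDyer.Theorems
open Summit.BirchSwinnertonDyer.BirchSwinnertonDyer.Theorems.UniversalToricDescentTwinControlGlue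
open Summit.BirchSwinnertonDyer.BirchSwinnertonDyer.Theorems.UniversalToricDescentTwinHowardConclusion
open Summit.BirchSwinnertonDyer.BirchSwinnertonDyer.Theorems.HeegnerMuPartStabilized

namespace Summit.BirchSwinnertonDyer.BirchSwinnertonDyer.Theorems.UniversalToricDescentTwinHowardRank

/-! ## §1 The rank readout glue, generic in the `DVRSetting` over `S_m` -/

set_option maxHeartbeats 1600000 in
set_option synthInstance.maxHeartbeats 200000 in
/-- **`λ(𝒳/q_m 𝒳) ≤ m` from Howard's conclusion and an injective readout with (hT)/(hSel)/(hfin, hidx).**  GENERIC in the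
`DVRSetting` `St` over `S_m = Λ/(q_m)`: from `St.Conclusion hy one` take `Φ : H¹_{F_𝔮}(K, A_𝔮) ≃ 𝒟 × (M × M)` (`M` finite,
`S_m`-semilinear on representatives); `ι𝒜 := ι₀ ∘ Φ⁻¹ : 𝒟 × (M × M) →+ Sel_∞` lands in `ker ψ_m` ((hT) + `q_m = 0` in `S_m`),
has range `ι₀(H¹_{F_𝔮}) ∩ Sel_∞` of index `≤ c` in `ker ψ_m` ((hfin, hidx)) and is injective (`ι₀` is); then utd-p1-w2's
`lambdaInvariant_quotient_qm_le_of_howardShape_readout` with `e := 0`.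
[cite: Howard2004HeegnerKolyvagin, Thm. 1.6.1 (ii), Prop. 2.2.8 and proof of Thm. 2.2.10 (𝔮 = T^m + p)] [cite: GreenbergLNM1716, §4 p. 98] -/
theorem lambdaInvariant_le_of_dvrConclusion_of_readout {p : ℕ} [hp : Fact p.Prime] {m : ℕ} (hm : 1 ≤ m)
    [IsDomain (IwasawaAlgebra p ⧸
      Ideal.span {(PowerSeries.X ^ m + PowerSeries.C (p : ℤ_[p]) : IwasawaAlgebra p)})]
    [IsDiscreteValuationRing (IwasawaAlgebra p ⧸
      Ideal.span {(PowerSeries.X ^ m + PowerSeries.C (p : ℤ_[p]) : IwasawaAlgebra p)})]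
    {K : Type} [Field K] [NumberField K] (V : WeierstrassCurve K) [V.IsElliptic] {κ : ZpExtension K p}
    {γ : absoluteGaloisGroup K} (𝒳 : V.SelmerDualData κ γ) [Module.Finite (IwasawaAlgebra p) 𝒳.X]
    {N : ℕ → Type} [∀ k, AddCommGroup (N k)] [∀ k, TopologicalSpace (N k)]
    [∀ k, DiscreteTopology (N k)]
    [∀ k, Module (IwasawaAlgebra p ⧸
      Ideal.span {(PowerSeries.X ^ m + PowerSeries.C (p : ℤ_[p]) : IwasawaAlgebra p)}) (N k)]
    {Rk : ℕ → Type} [∀ k, CommRing (Rk k)] [∀ k, IsLocalRing (Rk k)] [∀ k, TopologicalSpace (Rk k)]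
    [∀ k, DiscreteTopology (Rk k)] [∀ k, Algebra ℤ_[p] (Rk k)]
    [∀ k, Algebra (IwasawaAlgebra p ⧸
      Ideal.span {(PowerSeries.X ^ m + PowerSeries.C (p : ℤ_[p]) : IwasawaAlgebra p)}) (Rk k)]
    [∀ k, Module (Rk k) (N k)]
    [∀ k, IsScalarTower (IwasawaAlgebra p ⧸
      Ideal.span {(PowerSeries.X ^ m + PowerSeries.C (p : ℤ_[p]) : IwasawaAlgebra p)}) (Rk k) (N k)]
    {Nbar : Type} [AddCommGroup Nbar] [TopologicalSpace Nbar] [DiscreteTopology Nbar]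
    [∀ k, Module (Rk k) Nbar]
    {Nq : ℕ → Finset (HeightOneSpectrum (𝓞 K)) → Type} [∀ k n, AddCommGroup (Nq k n)]
    [∀ k n, TopologicalSpace (Nq k n)] [∀ k n, DiscreteTopology (Nq k n)]
    [∀ k n, Module (Rk k) (Nq k n)]
    [∀ k n, Module (IwasawaAlgebra p ⧸
      Ideal.span {(PowerSeries.X ^ m + PowerSeries.C (p : ℤ_[p]) : IwasawaAlgebra p)}) (Nq k n)]
    [∀ k n, IsScalarTower (IwasawaAlgebra p ⧸
      Ideal.span {(PowerSeries.X ^ m + PowerSeries.C (p : ℤ_[p]) : IwasawaAlgebra p)}) (Rk k) (Nq k n)]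
    (St : DVRSetting p K (IwasawaAlgebra p ⧸
      Ideal.span {(PowerSeries.X ^ m + PowerSeries.C (p : ℤ_[p]) : IwasawaAlgebra p)}) N Rk Nbar Nq)
    (hy : St.SatisfiesH)
    (hπ : St.π ∈ IsLocalRing.maximalIdeal (IwasawaAlgebra p ⧸
      Ideal.span {(PowerSeries.X ^ m + PowerSeries.C (p : ℤ_[p]) : IwasawaAlgebra p)}))
    (he : ∀ k, St.e k ≤ St.e (k + 1))
    -- Howard's conclusion at some bottom class (UNOPENED; only its shape (ii) is used)
    (one : ∀ k, galoisCohomology (St.T.ρ k) 1) (hconc : St.Conclusion hy one)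
    -- the READOUT of `H¹(K, A)` into `H¹(K_∞, E[p^∞])`, injective, and its three properties
    (ι₀ : AdicTower.H1A St.T St.π St.e hy.killed hy.ker_red hπ he →+ V.subgroupH1 p κ.kerSubgroup)
    (hι₀ : Function.Injective ι₀)
    (θ : AddMonoid.End (V.subgroupH1 p κ.kerSubgroup)) (hθ : ∀ s, θ s = V.conjH1 p κ.kerSubgroup γ s)
    (hT : ∀ (j : ℕ) (cj : galoisCohomology (St.T.ρ j) 1),
      ι₀ (AddCommGroup.DirectLimit.of (fun k => galoisCohomology (St.T.ρ k) 1)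
            (AdicTower.incH1LE St.T St.π St.e hy.killed hy.ker_red hπ he) j
            (scalarMapH1 _ (St.T.hlin j)
              (Ideal.Quotient.mk (Ideal.span {(PowerSeries.X ^ m + PowerSeries.C (p : ℤ_[p]) : IwasawaAlgebra p)})
                PowerSeries.X) cj)) =
        θ (ι₀ (AddCommGroup.DirectLimit.of (fun k => galoisCohomology (St.T.ρ k) 1)
            (AdicTower.incH1LE St.T St.π St.e hy.killed hy.ker_red hπ he) j cj)) -
          ι₀ (AddCommGroup.DirectLimit.of (fun k => galoisCohomology (St.T.ρ k) 1)
            (AdicTower.incH1LE St.T St.π St.e hy.killed hy.ker_red hπ he) j cj))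
    (hSel : ∀ a ∈ St.T.selmerA St.π St.e hy.killed hy.ker_red hπ he (fun k => (St.t k).cond),
      ι₀ a ∈ V.selmerInfty κ)
    (c : ℕ)
    (hfin : Finite (↥(((V.conjSelmerInfty κ γ - 1) ^ m + (p : AddMonoid.End (V.selmerInfty κ))).ker) ⧸
      (((St.T.selmerA St.π St.e hy.killed hy.ker_red hπ he (fun k => (St.t k).cond)).map ι₀).comap
          (V.selmerInfty κ).subtype).addSubgroupOf
        (((V.conjSelmerInfty κ γ - 1) ^ m + (p : AddMonoid.End (V.selmerInfty κ))).ker)))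
    (hidx : Nat.card (↥(((V.conjSelmerInfty κ γ - 1) ^ m + (p : AddMonoid.End (V.selmerInfty κ))).ker) ⧸
      (((St.T.selmerA St.π St.e hy.killed hy.ker_red hπ he (fun k => (St.t k).cond)).map ι₀).comap
          (V.selmerInfty κ).subtype).addSubgroupOf
        (((V.conjSelmerInfty κ γ - 1) ^ m + (p : AddMonoid.End (V.selmerInfty κ))).ker)) ≤ c) :
    lambdaInvariant p (𝒳.X ⧸ ((Ideal.span {(PowerSeries.X ^ m + PowerSeries.C (p : ℤ_[p]) : IwasawaAlgebra p)} :
      Ideal (IwasawaAlgebra p)) • (⊤ : Submodule (IwasawaAlgebra p) 𝒳.X))) ≤ m := by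
  -- (ii) opened in honest-module currency
  obtain ⟨x, -, M, iM₁, iM₂, iM₃, Φ, -, hrep, -⟩ := DVRSetting.Conclusion.exists_semilinear St hy hπ he hconc
  -- (hT) on representatives ⟹ (hT) on `𝒟 × (M × M)` through `Φ⁻¹`
  have hTP : ∀ y : (FracModR (IwasawaAlgebra p ⧸ Ideal.span {(PowerSeries.X ^ m + PowerSeries.C (p : ℤ_[p]) : IwasawaAlgebra p)}) × (M × M)),
      ι₀ ((Φ.symm (Ideal.Quotient.mk (Ideal.span {(PowerSeries.X ^ m + PowerSeries.C (p : ℤ_[p]) : IwasawaAlgebra p)}) PowerSeries.X • y) : ↥(St.T.selmerA St.π St.e hy.killed hy.ker_red hπ he (fun k => (St.t k).cond))) : (AdicTower.H1A St.T St.π St.e hy.killed hy.ker_red hπ he)) =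
        θ (ι₀ ((Φ.symm y : ↥(St.T.selmerA St.π St.e hy.killed hy.ker_red hπ he (fun k => (St.t k).cond))) : (AdicTower.H1A St.T St.π St.e hy.killed hy.ker_red hπ he))) - ι₀ ((Φ.symm y : ↥(St.T.selmerA St.π St.e hy.killed hy.ker_red hπ he (fun k => (St.t k).cond))) : (AdicTower.H1A St.T St.π St.e hy.killed hy.ker_red hπ he)) := by
    intro y
    obtain ⟨j, cj, hjc⟩ := AdicTower.exists_of_eq St.T St.π St.e hy.killed hy.ker_red hπ he
      ((Φ.symm y : ↥(St.T.selmerA St.π St.e hy.killed hy.ker_red hπ he (fun k => (St.t k).cond))) : (AdicTower.H1A St.T St.π St.e hy.killed hy.ker_red hπ he))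
    have hc : (AddCommGroup.DirectLimit.of (fun k => galoisCohomology (St.T.ρ k) 1) (AdicTower.incH1LE St.T St.π St.e hy.killed hy.ker_red hπ he) j) cj ∈ (St.T.selmerA St.π St.e hy.killed hy.ker_red hπ he (fun k => (St.t k).cond)) := hjc ▸ (Φ.symm y).2
    have hy' : Φ ⟨_, hc⟩ = y := by
      have h1 : (⟨_, hc⟩ : ↥(St.T.selmerA St.π St.e hy.killed hy.ker_red hπ he (fun k => (St.t k).cond))) = Φ.symm y := Subtype.ext hjc
      rw [h1, AddEquiv.apply_symm_apply]
    have hr : ((Φ.symm (Ideal.Quotient.mk (Ideal.span {(PowerSeries.X ^ m + PowerSeries.C (p : ℤ_[p]) : IwasawaAlgebra p)}) PowerSeries.X • y) : ↥(St.T.selmerA St.π St.e hy.killed hy.ker_red hπ he (fun k => (St.t k).cond))) : (AdicTower.H1A St.T St.π St.e hy.killed hy.ker_red hπ he)) =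
        (AddCommGroup.DirectLimit.of (fun k => galoisCohomology (St.T.ρ k) 1) (AdicTower.incH1LE St.T St.π St.e hy.killed hy.ker_red hπ he) j) (scalarMapH1 _ (St.T.hlin j) (Ideal.Quotient.mk (Ideal.span {(PowerSeries.X ^ m + PowerSeries.C (p : ℤ_[p]) : IwasawaAlgebra p)}) PowerSeries.X) cj) := by
      conv_lhs => rw [← hy']
      exact hrep j _ cj hc
    rw [hr, hT, hjc]
  -- `Λ` acts on `P := 𝒟 × (M × M)` through `Λ → S_m`
  letI instΛ : Module (IwasawaAlgebra p) (FracModR (IwasawaAlgebra p ⧸ Ideal.span {(PowerSeries.X ^ m + PowerSeries.C (p : ℤ_[p]) : IwasawaAlgebra p)}) × (M × M)) := Module.compHom _ (Ideal.Quotient.mk (Ideal.span {(PowerSeries.X ^ m + PowerSeries.C (p : ℤ_[p]) : IwasawaAlgebra p)}))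
  haveI : Finite M := iM₃
  -- the comparison `ι𝒜 := ι₀ ∘ Φ⁻¹ : P → Sel_∞` (lands in `Sel_∞` by (hSel))
  let ι𝒜 : (FracModR (IwasawaAlgebra p ⧸ Ideal.span {(PowerSeries.X ^ m + PowerSeries.C (p : ℤ_[p]) : IwasawaAlgebra p)}) × (M × M)) →+ V.selmerInfty κ :=
    (ι₀.comp ((St.T.selmerA St.π St.e hy.killed hy.ker_red hπ he (fun k => (St.t k).cond)).subtype.comp Φ.symm.toAddMonoidHom)).codRestrict (V.selmerInfty κ) (fun y ↦ hSel _ (Φ.symm y).2)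
  have hι𝒜_coe : ∀ y, (ι𝒜 y : V.subgroupH1 p κ.kerSubgroup) = ι₀ ((Φ.symm y : ↥(St.T.selmerA St.π St.e hy.killed hy.ker_red hπ he (fun k => (St.t k).cond))) : (AdicTower.H1A St.T St.π St.e hy.killed hy.ker_red hπ he)) := fun _ ↦ rfl
  -- (hT) ⟹ `ι𝒜 (T • y) = (conj_γ - 1) (ι𝒜 y)`
  have hT' : ∀ y, ι𝒜 ((PowerSeries.X : IwasawaAlgebra p) • y) = (V.conjSelmerInfty κ γ - 1) (ι𝒜 y) := by
    intro y
    apply Subtype.ext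
    rw [hι𝒜_coe, show (PowerSeries.X : IwasawaAlgebra p) • y = Ideal.Quotient.mk (Ideal.span {(PowerSeries.X ^ m + PowerSeries.C (p : ℤ_[p]) : IwasawaAlgebra p)}) PowerSeries.X • y from rfl, hTP, ← hι𝒜_coe, IwasawaDual.End_sub_apply, AddMonoid.End.one_apply, AddSubgroupClass.coe_sub,
      WeierstrassCurve.coe_conjSelmerInfty_apply, hθ]
  -- `ψ_m` kills `ι𝒜(P)`: `(T^m + p) • y = 0` in `P`
  have h0 : Ideal.Quotient.mk (Ideal.span {(PowerSeries.X ^ m + PowerSeries.C (p : ℤ_[p]) : IwasawaAlgebra p)}) ((PowerSeries.X : IwasawaAlgebra p) ^ m + (p : IwasawaAlgebra p)) = 0 := by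
    rw [Ideal.Quotient.eq_zero_iff_mem, ← map_natCast (PowerSeries.C : ℤ_[p] →+* IwasawaAlgebra p) p]
    exact Ideal.mem_span_singleton_self _
  have hkill : ∀ b : (FracModR (IwasawaAlgebra p ⧸ Ideal.span {(PowerSeries.X ^ m + PowerSeries.C (p : ℤ_[p]) : IwasawaAlgebra p)}) × (M × M)), ((PowerSeries.X : IwasawaAlgebra p) ^ m + (p : IwasawaAlgebra p)) • b = 0 := by
    intro b
    rw [show ((PowerSeries.X : IwasawaAlgebra p) ^ m + (p : IwasawaAlgebra p)) • b = Ideal.Quotient.mk (Ideal.span {(PowerSeries.X ^ m + PowerSeries.C (p : ℤ_[p]) : IwasawaAlgebra p)}) ((PowerSeries.X : IwasawaAlgebra p) ^ m + (p : IwasawaAlgebra p)) • b from rfl, h0]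
    exact zero_smul (IwasawaAlgebra p ⧸ Ideal.span {(PowerSeries.X ^ m + PowerSeries.C (p : ℤ_[p]) : IwasawaAlgebra p)}) b
  have hι : ∀ b, ((V.conjSelmerInfty κ γ - 1) ^ m + (p : AddMonoid.End (V.selmerInfty κ))) (ι𝒜 b) = 0 :=
    fun b ↦ psi_apply_eq_zero_of_X_compat m V γ ι𝒜 hT' b (hkill b)
  -- `range ι𝒜 = ι₀(H¹_F) ∩ Sel_∞` (`Φ` is onto)
  have hrange : ι𝒜.range = ((St.T.selmerA St.π St.e hy.killed hy.ker_red hπ he (fun k => (St.t k).cond)).map ι₀).comap (V.selmerInfty κ).subtype := by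
    ext s
    constructor
    · rintro ⟨y, rfl⟩
      exact ⟨_, (Φ.symm y).2, rfl⟩
    · rintro ⟨a, ha, has⟩
      refine ⟨Φ ⟨a, ha⟩, Subtype.ext ?_⟩
      rw [hι𝒜_coe, AddEquiv.symm_apply_apply]
      exact has
  rw [← hrange] at hfin hidx
  -- the readout is injective ⟹ `ι𝒜` is injective (`e := 0`)
  have hinj : ∀ a, ι𝒜 a = 0 → p ^ 0 • a = 0 := by
    intro a ha
    rw [pow_zero, one_smul]
    have h1 : ι₀ ((Φ.symm a : ↥(St.T.selmerA St.π St.e hy.killed hy.ker_red hπ he (fun k => (St.t k).cond))) : (AdicTower.H1A St.T St.π St.e hy.killed hy.ker_red hπ he)) = 0 := by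
      rw [← hι𝒜_coe, ha]; rfl
    have h2 : ((Φ.symm a : ↥(St.T.selmerA St.π St.e hy.killed hy.ker_red hπ he (fun k => (St.t k).cond))) : (AdicTower.H1A St.T St.π St.e hy.killed hy.ker_red hπ he)) = 0 :=
      hι₀ (by rw [h1, map_zero])
    have h3 : Φ.symm a = 0 := Subtype.ext h2
    simpa using congrArg Φ h3
  exact UniversalToricDescentEisensteinHowardRankReadout.lambdaInvariant_quotient_qm_le_of_howardShape_readout 𝒳 hm ι𝒜 hι c
    hfin hidx 0 hinj

/-! ## §2 On the twin frame: (H-ii) from Howard's conclusion at the control levels -/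

set_option maxHeartbeats 1600000 in
set_option synthInstance.maxHeartbeats 80000 in
/-- **(H-ii) from Howard's conclusion, on the twin frame at a prime `p` where (B5) holds**: for `W/ℚ` elliptic, `K` imaginary
quadratic, `p ≠ 2`, `κ` anticyclotomic, Heegner for `N`, `γ` a topological generator, `E(K)[p] = 0`, multiplicative reduction
above `p`, (B5) `Stmt.readoutIndexMultAt p`, a dual datum `𝒳` with `𝒳.X` f.g., and a class `z` of a `Λ`-adic Selmer datum `D`:
`Stmt.conclusionAtControlLevels p N W K κ γ hγ hE D z` ⟹ `∀ m₀ ∃ m ≥ m₀, λ(𝒳.X/q_m) ≤ m + C` (every `C`).  Per large `m`: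
the datum + `hy` + `Conclusion` from the predicate, (hSel) from `readoutSelmerMultAt_holds`, (hfin, hidx) from (B5), (hT) from
`eisensteinTowerReadout_of_scalarMapH1_mk_X`, injectivity from `eisensteinTowerReadout_injective`, then §1.
[cite: Howard2004HeegnerKolyvagin, Thm. 1.6.1 (ii), Prop. 2.2.8 and proof of Thm. 2.2.10 (𝔮 = T^m + p)] -/
theorem hrank_of_conclusion {p : ℕ} [Fact p.Prime] (hB5 : Stmt.readoutIndexMultAt p)
    (N : ℕ) [NeZero N] (W : WeierstrassCurve ℚ) [W.IsElliptic] [W.IsGloballyMinimal]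
    (K : Type) [Field K] [NumberField K] (κ : ZpExtension K p) (γ : Field.absoluteGaloisGroup K)
    (hK : IsImaginaryQuadratic K) (hp2 : p ≠ 2) (hκ : κ.IsAnticyclotomic) (hHeeg : SatisfiesHeegnerHypothesis N K)
    (hγ : κ.IsTopGenerator γ) (hE : ∀ Q : (W.baseChange K).toAffine.Point, p • Q = 0 → Q = 0)
    (hmultp : ∀ v : IsDedekindDomain.HeightOneSpectrum (NumberField.RingOfIntegers K),
      ((p : ℕ) : NumberField.RingOfIntegers K) ∈ v.asIdeal → (W.baseChange K).HasMultiplicativeReductionAt v)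
    (D : (W.baseChange K).LambdaAdicSelmerData κ γ) (𝒳 : (W.baseChange K).SelmerDualData κ γ)
    [Module.Finite (IwasawaAlgebra p) 𝒳.X] (z : D.S)
    (hconc : Stmt.conclusionAtControlLevels p N W K κ γ hγ hE D z) (C : ℕ) :
    ∀ m₀ : ℕ, ∃ m : ℕ, m₀ ≤ m ∧
      lambdaInvariant p (𝒳.X ⧸ ((Ideal.span {(PowerSeries.X ^ m + PowerSeries.C (p : ℤ_[p]) : IwasawaAlgebra p)} :
        Ideal (IwasawaAlgebra p)) • (⊤ : Submodule (IwasawaAlgebra p) 𝒳.X))) ≤ m + C := by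
  obtain ⟨m₁, hc⟩ := hconc
  obtain ⟨m₄, hSelAll⟩ := readoutSelmerMultAt_holds p N W K κ γ hK hp2 hκ hHeeg hγ hE hmultp
  obtain ⟨c₂, m₃, hIdxAll⟩ := hB5 N W K κ γ hK hp2 hκ hHeeg hγ hE hmultp
  intro m₀
  refine ⟨m₀ + m₁ + m₃ + m₄ + 1, by omega, ?_⟩
  have hm : 1 ≤ m₀ + m₁ + m₃ + m₄ + 1 := by omega
  -- abbreviate the large `m`
  generalize hmdef : m₀ + m₁ + m₃ + m₄ + 1 = m at hm ⊢
  have hm₁ : m₁ ≤ m := by omega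
  have hm₃ : m₃ ≤ m := by omega
  have hm₄ : m₄ ≤ m := by omega
  letI := IwasawaAlgebra.isDomain_quotient_X_pow_add_C p hm
  letI := IwasawaAlgebra.isDiscreteValuationRing_quotient_X_pow_add_C p hm
  haveI := IwasawaAlgebra.EisensteinCoeff.isLocalRing_succ p hm
  letI := IwasawaAlgebra.EisensteinCoeff.algebraOfSpecSucc p m
  haveI := W.isScalarTower_algebraOfSpecSucc (K := K) (p := p) (m := m)
  letI := W.residueModuleSucc (K := K) (p := p) hm
  obtain ⟨S, hpS, hbad, hSN, hSσ, L, hL, hLS, jbar', cd, Dd, fs, t, ht, I, hy, hconcl⟩ := hc m hm hm₁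
  -- the four bookkeeping proofs of the readout
  have hπ₀ : (W.eisensteinDVRSetting (κ.unitTwist (-1)) hm S hpS hbad L hL hLS jbar' cd Dd fs).π ∈ IsLocalRing.maximalIdeal (IwasawaAlgebra p ⧸ Ideal.span {(PowerSeries.X ^ m + PowerSeries.C (p : ℤ_[p]) : IwasawaAlgebra p)}) := by
    rw [hy.unif]; exact Ideal.mem_span_singleton_self _
  have he₀ : ∀ k, (W.eisensteinDVRSetting (κ.unitTwist (-1)) hm S hpS hbad L hL hLS jbar' cd Dd fs).e k ≤ (W.eisensteinDVRSetting (κ.unitTwist (-1)) hm S hpS hbad L hL hLS jbar' cd Dd fs).e (k + 1) := fun k ↦ (hy.e_strictMono (Nat.lt_succ_self k)).le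
  have hπX : (W.eisensteinDVRSetting (κ.unitTwist (-1)) hm S hpS hbad L hL hLS jbar' cd Dd fs).π = Ideal.Quotient.mk (Ideal.span {(PowerSeries.X ^ m + PowerSeries.C (p : ℤ_[p]) : IwasawaAlgebra p)}) PowerSeries.X := rfl
  have hek : ∀ k, (W.eisensteinDVRSetting (κ.unitTwist (-1)) hm S hpS hbad L hL hLS jbar' cd Dd fs).e (k + 1) - (W.eisensteinDVRSetting (κ.unitTwist (-1)) hm S hpS hbad L hL hLS jbar' cd Dd fs).e k = m := by
    intro k
    rw [W.eisensteinDVRSetting_e, W.eisensteinDVRSetting_e, Nat.mul_succ, Nat.add_sub_cancel_left]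
  -- (B4), (B5) at this `m` and datum
  have hSel := hSelAll m hm hm₄ S hpS hbad hSN hSσ L hL hLS jbar' cd Dd fs hy hπ₀ he₀ hπX hek
  obtain ⟨hfin, hidx⟩ := hIdxAll m hm hm₃ S hpS hbad hSN hSσ L hL hLS jbar' cd Dd fs hy hπ₀ he₀ hπX hek
  refine (lambdaInvariant_le_of_dvrConclusion_of_readout hm (W.baseChange K) 𝒳
    (W.eisensteinDVRSetting (κ.unitTwist (-1)) hm S hpS hbad L hL hLS jbar' cd Dd fs) hy hπ₀ he₀ _ hconcl
    (W.eisensteinTowerReadout κ hm (W.eisensteinDVRSetting (κ.unitTwist (-1)) hm S hpS hbad L hL hLS jbar' cd Dd fs).π (W.eisensteinDVRSetting (κ.unitTwist (-1)) hm S hpS hbad L hL hLS jbar' cd Dd fs).e hy.killed hy.ker_red hπ₀ he₀ hπX hek)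
    (W.eisensteinTowerReadout_injective κ hm _ _ hy.killed hy.ker_red hπ₀ he₀ hπX hek hγ hE)
    ((W.baseChange K).conjH1 p κ.kerSubgroup γ) (fun _ ↦ rfl)
    (fun j cj ↦ W.eisensteinTowerReadout_of_scalarMapH1_mk_X κ hm (W.eisensteinDVRSetting (κ.unitTwist (-1)) hm S hpS hbad L hL hLS jbar' cd Dd fs).π (W.eisensteinDVRSetting (κ.unitTwist (-1)) hm S hpS hbad L hL hLS jbar' cd Dd fs).e hy.killed hy.ker_red hπ₀ he₀ hπX hek
      hγ _ (fun _ ↦ rfl) j cj)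
    hSel (p ^ c₂) hfin hidx).trans ?_
  omega

/-- **(H-ii) of `stub_howardOutputsOfFamily` from Howard's conclusion at the control levels**, in the binders of crux 24737
(`Rank1Residual.Mult W′ 3`, `ρ̄_{W′,3}` onto, `K` imaginary quadratic Heegner for `N′`, `κ` anticyclotomic, `γ` a topological
generator): `Stmt.conclusionAtControlLevels 3 … Dat z` ⟹ `∀ m₀ ∃ m ≥ m₀, λ(X/q_m X) ≤ m + C` for
`X = (W′.baseChange K).selmerDualData κ hγ` and every `C` — the stub's second conjunct VERBATIM, unconditionally ((B5) at `3` =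
`readoutIndexMultAt_three`, `E(K)[3] = 0` by `baseChange_noPTorsion_of_surjective`, multiplicative reduction above `3` by `Mult W′ 3`).
[cite: Howard2004HeegnerKolyvagin, Thm. 1.6.1 (ii), Prop. 2.2.8 and proof of Thm. 2.2.10 (𝔮 = T^m + p)] [cite: GreenbergLNM1716, §1 p. 60] -/
theorem twin_hrank_of_conclusion
    (W' : WeierstrassCurve ℚ) [W'.IsElliptic] [W'.IsGloballyMinimal] (N' : ℕ) [NeZero N']
    (K : Type) [Field K] [NumberField K]
    (hm3 : Rank1Residual.Mult W' 3) (hsurj : W'.HasSurjectiveModNGaloisRep 3) (hK : IsImaginaryQuadratic K)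
    (hH : SatisfiesHeegnerHypothesis N' K) (κ : ZpExtension K 3) (hκ : κ.IsAnticyclotomic)
    (γ : absoluteGaloisGroup K) [hγ : Fact (κ.IsTopGenerator γ)]
    (Dat : (W'.baseChange K).LambdaAdicSelmerData κ γ) (z : Dat.S)
    (hconc : Stmt.conclusionAtControlLevels 3 N' W' K κ γ hγ.out
      (UniversalToricDescentTowerTorsion.baseChange_noPTorsion_of_surjective W' 3 hsurj K hK) Dat z) (C : ℕ) :
    ∀ m₀ : ℕ, ∃ m : ℕ, m₀ ≤ m ∧
      lambdaInvariant 3 (((W'.baseChange K).selmerDualData κ hγ.out).X ⧸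
        (Ideal.span {(PowerSeries.X ^ m + PowerSeries.C ((3 : ℕ) : ℤ_[3]) : IwasawaAlgebra 3)} •
          (⊤ : Submodule (IwasawaAlgebra 3) ((W'.baseChange K).selmerDualData κ hγ.out).X))) ≤ m + C := by
  haveI : Module.Finite (IwasawaAlgebra 3) ((W'.baseChange K).selmerDualData κ hγ.out).X :=
    ((W'.baseChange K).selmerDualData κ hγ.out).module_finite_holds hγ.out
  exact hrank_of_conclusion UniversalToricDescentTwinReadoutIndex.readoutIndexMultAt_three N' W' K κ γ hK (by decide) hκ hH hγ.out
    (UniversalToricDescentTowerTorsion.baseChange_noPTorsion_of_surjective W' 3 hsurj K hK)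
    (fun w hw ↦ UniversalToricDescentTwinTateLineAtThree.hasMultiplicativeReductionAt_baseChange_of_mult_three W' hm3 K w hw)
    Dat _ z hconc C

end Summit.BirchSwinnertonDyer.BirchSwinnertonDyer.Theorems.UniversalToricDescentTwinHowardRank

end
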